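import Mathlib
import Literature.Analysis.FluidPDE.AxisymHouLiVariables
import Literature.Analysis.FluidPDE.AxisymQuotientEquations
import Literature.Analysis.FluidPDE.AxisymmetricVorticityTransport
import Literature.Analysis.FluidPDE.AxisymmetricLiftR5
import Literature.Analysis.FluidPDE.HouLiSpaceTime
import Literature.Analysis.FluidPDE.SwirlTransportProofs
import Literature.Analysis.FluidPDE.AxisymTransportIBP
import Literature.Analysis.FluidPDE.ClassicalSolutionGlue
import Literature.Analysis.FluidPDE.EnergyToolkit
import Literature.Analysis.FluidPDE.MildSolutionProofs
import Literature.Analysis.FluidPDE.WholeSpaceIBP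
import HarnessLib

/-!
# Conservation of `∫ W²` for a transported scalar, and of `‖r u_θ‖_{L^{2k}}` along classical
# axisymmetric EULER flows on `(−∞, 0)` (helper of the axisymmetric DSS strata of the crux
# `EulerZoomLiouville.PowerGaugeEulerLiouville`, route №10, item stmt-NavierStokesRegularity-19832)

Helper file (theorems only; `--supports stmt-NavierStokesRegularity-19832`). Seat ns-typeII-p3 (cell
ns-regularity-ideate §B, D-0081), rungs C1/C2 ∩ {axisymmetric} of
`Cruxes/PowerGaugeEulerLiouville/Lines/rungC_window.lean`.

* `integral_sq_eq_of_transport` — **abstract conservation law.** If `W` is a jointly smooth scalar family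
  on `[0, T] × ℝ³` TRANSPORTED by a family of divergence-free `C¹` fields `v(σ)`,
  `∂ₜW = −DW[v]` pointwise, with `v`, `Dv` bounded and `W(σ) ∈ L²`, `∫ W(σ)² ≤ N` on `[0, T]`, then
  `∫ W(T)² = ∫ W(0)²` (cut-off `χ_R`, the tree's time-integration identity
  `IsSmoothSpaceTimeOn.integral_Ioo_integral_mul_timeDerivWithin_mul`, transport integration by parts
  `integral_mul_fderiv_apply_eq_neg_of_isDivFree'`, `R → ∞`). The prequel `…AxisymNoSwirlTransport.lean`
  is the instance `W = ω_θ/r`.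
* `timeDerivWithin_swirl_eq_neg` — **`∂ₜΓ = −DΓ[u]` everywhere** for the swirl `Γ = r u_θ = swirl (u t)`
  of a classical axisymmetric EULER flow (Kelvin / KNSS 2009 (1.8) at `ν = 0`: the tree's
  `swirl_transport_holds` off the axis, extended across the axis by continuity), and the same for the
  powers `Γ^k` (`timeDerivWithin_swirl_pow_eq_neg`).
* `integral_swirl_pow_eq_of_classical` — **conservation of `∫ Γ^{2k}`** (`k : ℕ`) along a classical
  axisymmetric Euler flow on `(−∞, 0)` under the cut-off hypotheses (bounded `u`, `∇u`; `Γ^k ∈ L²` with a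
  uniform bound on the compact time interval).

In print: Chae, CMP 273 (2007), «Note added» p. 6 (`D/Dt (r v^θ) = 0` as the transported quantity of
his Thm 2.2, for SELF-SIMILAR axisymmetric blow-up with `curl V ∈ H^m`); here for classical flows on the
open ancient slab with the minimal integrability the cut-off argument needs. WHAT THIS IS NOT: not NS,
not the crux — conservation laws of classical axisymmetric Euler flows. [folklore]
-/

noncomputable section

-- the summit and its single problem share the name `NavierStokesRegularity` (D-0017 nested layout)
set_option linter.dupNamespace false

open Set Function Filter Topology MeasureTheory Metric
open scoped NNReal ENNReal InnerProductSpace RealInnerProductSpace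

namespace Summit.NavierStokesRegularity.NavierStokesRegularity.Theorems.PowerGaugeEulerLiouville.AxisymNoSwirl

open Literature.Analysis Literature.Analysis.FluidPDE

/-! ## Abstract conservation of `∫ W²` for a transported scalar -/

/-- **The localized slice identity for a transported scalar**: if `∂ₜW(σ) = −DW(σ)[v(σ)]` pointwise,
`v(σ) ∈ C¹` divergence free, bounded with bounded gradient, then against `χ = cutoff R`,
`∫ χ (∂ₜW · W) = ½ ∫ Dχ[v] W²`. [folklore] -/
theorem integral_cutoff_mul_timeDerivWithin_mul_eq_of_transport {T : ℝ}
    {W : ℝ → (EuclideanSpace ℝ (Fin 3)) → ℝ} (hW : IsSmoothSpaceTimeOn (Icc 0 T) W)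
    {v : ℝ → (EuclideanSpace ℝ (Fin 3)) → (EuclideanSpace ℝ (Fin 3))}
    {σ : ℝ} (hσ : σ ∈ Icc 0 T) (hv1 : ContDiff ℝ 1 (v σ)) (hdiv : VectorCalculus.IsDivFree (v σ))
    (htr : ∀ x, FluidPDE.timeDerivWithin (Icc 0 T) W σ x = -(fderiv ℝ (W σ) x (v σ x)))
    {B : ℝ} (hB : ∀ y, ‖v σ y‖ ≤ B ∧ ‖fderiv ℝ (v σ) y‖ ≤ B) {R : ℝ} (hR : 0 < R) :
    ∫ x, cutoff R x * (FluidPDE.timeDerivWithin (Icc 0 T) W σ x * W σ x) =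
      2⁻¹ * ∫ x, fderiv ℝ (cutoff R) x (v σ x) * W σ x ^ 2 := by
  have hWs := hW.contDiff_slice hσ
  have hW1 : ContDiff ℝ 1 (W σ) := hWs.of_le (by norm_cast)
  have hW2 : ContDiff ℝ 1 (fun y => W σ y ^ 2) := hW1.pow 2
  have hχ : ContDiff ℝ 1 (cutoff (E := (EuclideanSpace ℝ (Fin 3))) R) := contDiff_cutoff R
  have hχc : HasCompactSupport (cutoff (E := (EuclideanSpace ℝ (Fin 3))) R) := hasCompactSupport_cutoff hR
  -- pointwise: `∂ₜW W = -½ D(W²)[v]`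
  have hpt : ∀ x, cutoff R x * (FluidPDE.timeDerivWithin (Icc 0 T) W σ x * W σ x) =
      -(2⁻¹) * (cutoff R x * fderiv ℝ (fun y => W σ y ^ 2) x (v σ x)) := by
    intro x
    rw [htr x]
    have hd : fderiv ℝ (fun y => W σ y ^ 2) x (v σ x) = 2 * W σ x * fderiv ℝ (W σ) x (v σ x) := by
      have hWx : DifferentiableAt ℝ (W σ) x := (hW1.differentiable one_ne_zero) x
      rw [show (fun y => W σ y ^ 2) = W σ ^ 2 from rfl, fderiv_pow _ hWx]
      simp [pow_one]
    rw [hd]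
    ring
  rw [integral_congr_ae (Eventually.of_forall hpt), integral_const_mul]
  -- integration by parts `∫ χ D(W²)[v] = -∫ Dχ[v] W²`
  have hcW2 : Continuous fun y => W σ y ^ 2 := hW2.continuous
  have hab : Integrable (fun x => cutoff R x * W σ x ^ 2) :=
    (hχ.continuous.mul hcW2).integrable_of_hasCompactSupport (hχc.mul_right)
  have hDab : ∀ i : Fin 3, Integrable
      (fun x => fderiv ℝ (cutoff R) x (EuclideanSpace.single i 1) * W σ x ^ 2) := fun i => by
    refine Continuous.integrable_of_hasCompactSupport ?_ ?_
    · exact ((hχ.continuous_fderiv one_ne_zero).clm_apply continuous_const).mul hcW2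
    · exact (hχc.fderiv_apply (𝕜 := ℝ) (EuclideanSpace.single i 1)).mul_right
  have haDb : ∀ i : Fin 3, Integrable
      (fun x => cutoff R x * fderiv ℝ (fun y => W σ y ^ 2) x (EuclideanSpace.single i 1)) := fun i => by
    refine Continuous.integrable_of_hasCompactSupport ?_ hχc.mul_right
    exact hχ.continuous.mul ((hW2.continuous_fderiv one_ne_zero).clm_apply continuous_const)
  have hibp := integral_mul_fderiv_apply_eq_neg_of_isDivFree' hχ hW2 hv1 hdiv
    (fun y => (hB y).1) (fun y => (hB y).2) hab hDab haDb
  rw [hibp]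
  ring

/-- **Conservation of `∫ W²` on `[0, T]` for a transported scalar** (`T > 0`): `W` jointly smooth on
`[0, T] × ℝ³`, `∂ₜW(σ) = −DW(σ)[v(σ)]` for a family of divergence-free `C¹` fields with `v`, `Dv`
bounded by `B`, and `W(σ) ∈ L²` with `∫ W(σ)² ≤ N` on `[0, T]` ⟹ `∫ W(T)² = ∫ W(0)²`. [folklore] -/
theorem integral_sq_eq_of_transport {T : ℝ} (hT : 0 < T)
    {W : ℝ → (EuclideanSpace ℝ (Fin 3)) → ℝ} (hW : IsSmoothSpaceTimeOn (Icc 0 T) W)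
    {v : ℝ → (EuclideanSpace ℝ (Fin 3)) → (EuclideanSpace ℝ (Fin 3))}
    (hv1 : ∀ σ ∈ Icc 0 T, ContDiff ℝ 1 (v σ)) (hdiv : ∀ σ ∈ Icc 0 T, VectorCalculus.IsDivFree (v σ))
    (htr : ∀ σ ∈ Icc 0 T, ∀ x, FluidPDE.timeDerivWithin (Icc 0 T) W σ x = -(fderiv ℝ (W σ) x (v σ x)))
    {B : ℝ} (hB : ∀ σ ∈ Icc 0 T, ∀ y, ‖v σ y‖ ≤ B ∧ ‖fderiv ℝ (v σ) y‖ ≤ B)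
    {N : ℝ} (hN : ∀ σ ∈ Icc 0 T, Integrable (fun y => W σ y ^ 2) ∧ ∫ y, W σ y ^ 2 ≤ N) :
    ∫ y, W T y ^ 2 = ∫ y, W 0 y ^ 2 := by
  obtain ⟨C, hC0, hC⟩ := exists_norm_fderiv_cutoff_le (E := (EuclideanSpace ℝ (Fin 3)))
  -- the localized balance at scale `R = n + 1`, bounded by `T · C B N / (2 (n+1))`
  have hloc : ∀ n : ℕ, |2⁻¹ * (∫ x, cutoff ((n : ℝ) + 1) x * W T x ^ 2) -
      2⁻¹ * (∫ x, cutoff ((n : ℝ) + 1) x * W 0 x ^ 2)| ≤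
      C / ((n : ℝ) + 1) * B * N * 2⁻¹ * T := by
    intro n
    have hR : (0 : ℝ) < (n : ℝ) + 1 := by positivity
    have hbal := hW.integral_Ioo_integral_mul_timeDerivWithin_mul hT
      (contDiff_cutoff (n := 0) ((n : ℝ) + 1)).continuous (hasCompactSupport_cutoff hR)
      (s := 0) (t := T) le_rfl hT.le le_rfl
    rw [← hbal]
    have hinner : ∀ σ ∈ Ioo 0 T, ‖∫ x, cutoff ((n : ℝ) + 1) x *
        (FluidPDE.timeDerivWithin (Icc 0 T) W σ x * W σ x)‖ ≤ C / ((n : ℝ) + 1) * B * N * 2⁻¹ := by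
      intro σ hσ
      have hσ' : σ ∈ Icc 0 T := Ioo_subset_Icc_self hσ
      rw [integral_cutoff_mul_timeDerivWithin_mul_eq_of_transport hW hσ' (hv1 σ hσ') (hdiv σ hσ')
        (htr σ hσ') (hB σ hσ') hR, Real.norm_eq_abs, abs_mul, abs_of_pos (by norm_num : (0 : ℝ) < 2⁻¹)]
      have := abs_integral_fderiv_cutoff_mul_sq_le' (hC _ hR) (fun y => (hB σ hσ' y).1)
        (hN σ hσ').1 (hN σ hσ').2
      nlinarith
    have h := norm_setIntegral_le_of_norm_le_const (μ := volume) (s := Ioo 0 T) (by simp) hinner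
    rw [Real.norm_eq_abs, Real.volume_real_Ioo_of_le hT.le, sub_zero] at h
    exact h
  -- the limits `R → ∞`
  have hlimT := tendsto_integral_cutoff_mul (hN T ⟨hT.le, le_rfl⟩).1
  have hlim0 := tendsto_integral_cutoff_mul (hN 0 ⟨le_rfl, hT.le⟩).1
  have hlim : Tendsto (fun n : ℕ => 2⁻¹ * (∫ x, cutoff ((n : ℝ) + 1) x * W T x ^ 2) -
      2⁻¹ * (∫ x, cutoff ((n : ℝ) + 1) x * W 0 x ^ 2)) atTop
      (𝓝 (2⁻¹ * (∫ x, W T x ^ 2) - 2⁻¹ * (∫ x, W 0 x ^ 2))) :=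
    (hlimT.const_mul _).sub (hlim0.const_mul _)
  have hbound : Tendsto (fun n : ℕ => C / ((n : ℝ) + 1) * B * N * 2⁻¹ * T) atTop (𝓝 0) := by
    have h1 : Tendsto (fun n : ℕ => C / ((n : ℝ) + 1)) atTop (𝓝 0) :=
      tendsto_const_nhds.div_atTop (tendsto_natCast_atTop_atTop.atTop_add tendsto_const_nhds)
    simpa using ((h1.mul_const B).mul_const N).mul_const 2⁻¹ |>.mul_const T
  have hzero : Tendsto (fun n : ℕ => 2⁻¹ * (∫ x, cutoff ((n : ℝ) + 1) x * W T x ^ 2) -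
      2⁻¹ * (∫ x, cutoff ((n : ℝ) + 1) x * W 0 x ^ 2)) atTop (𝓝 0) :=
    squeeze_zero_norm (fun n => by rw [Real.norm_eq_abs]; exact hloc n) hbound
  have heq := tendsto_nhds_unique hlim hzero
  linarith
where
  /-- The flux bound `|∫ Dχ_R[w] W²| ≤ (C/R) · B · N` (copy of the prequel's
  `abs_integral_fderiv_cutoff_mul_sq_le`, kept local to avoid a cross-file dependence). [folklore] -/
  abs_integral_fderiv_cutoff_mul_sq_le' {w : (EuclideanSpace ℝ (Fin 3)) → (EuclideanSpace ℝ (Fin 3))}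
      {W : (EuclideanSpace ℝ (Fin 3)) → ℝ} {B N C R : ℝ}
      (hC : ∀ x : (EuclideanSpace ℝ (Fin 3)), ‖fderiv ℝ (cutoff R) x‖ ≤ C / R)
      (hB : ∀ y, ‖w y‖ ≤ B) (hint : Integrable (fun y => W y ^ 2)) (hN : ∫ y, W y ^ 2 ≤ N) :
      |∫ x, fderiv ℝ (cutoff R) x (w x) * W x ^ 2| ≤ C / R * B * N := by
    have hC0 : 0 ≤ C / R := (norm_nonneg _).trans (hC 0)
    have hB0 : 0 ≤ B := (norm_nonneg _).trans (hB 0)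
    have hpt : ∀ x, ‖fderiv ℝ (cutoff R) x (w x) * W x ^ 2‖ ≤ C / R * B * W x ^ 2 := by
      intro x
      rw [norm_mul, Real.norm_of_nonneg (sq_nonneg _)]
      gcongr
      calc ‖fderiv ℝ (cutoff R) x (w x)‖ ≤ ‖fderiv ℝ (cutoff R) x‖ * ‖w x‖ :=
            (fderiv ℝ (cutoff R) x).le_opNorm _
        _ ≤ C / R * B := by gcongr; exacts [hC x, hB x]
    have h1 : ‖∫ x, fderiv ℝ (cutoff R) x (w x) * W x ^ 2‖ ≤ ∫ x, C / R * B * W x ^ 2 :=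
      norm_integral_le_of_norm_le (hint.const_mul _) (Eventually.of_forall hpt)
    rw [Real.norm_eq_abs, integral_const_mul] at h1
    exact h1.trans (by gcongr)

/-! ## The swirl `Γ = r u_θ` of a classical axisymmetric Euler flow is transported -/

/-- **`∂ₜΓ = −DΓ[u]` everywhere** for the swirl `Γ(t) = swirl (u t)` of a classical axisymmetric EULER
flow (`ν = 0`, `f = 0`) on a time set `S` of unique differentiability (KNSS 2009 (1.8) at `ν = 0`, the
tree's `swirl_transport_holds`, stated off the axis; both sides are continuous, so the identity extends
across the axis). [folklore] -/
theorem timeDerivWithin_swirl_eq_neg {S : Set ℝ} (hS : UniqueDiffOn ℝ S)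
    {v : ℝ → (EuclideanSpace ℝ (Fin 3)) → (EuclideanSpace ℝ (Fin 3))} {q : ℝ → (EuclideanSpace ℝ (Fin 3)) → ℝ}
    (hv : IsClassicalNSSolutionOn S 0 0 v q) (hax : ∀ σ ∈ S, IsAxisymmetric (v σ))
    {σ : ℝ} (hσ : σ ∈ S) (x : (EuclideanSpace ℝ (Fin 3))) :
    FluidPDE.timeDerivWithin S (fun s => swirl (v s)) σ x = -(fderiv ℝ (swirl (v σ)) x (v σ x)) := by
  have hq : ∀ s ∈ S, IsAxisymmetricScalar (q s) := fun s hs =>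
    hv.isAxisymmetricScalar_pressure hS hax (fun _ _ θ y => by ext i; fin_cases i <;> simp) hs
  have hvs := hv.contDiff_velocity hσ
  have hv2 : ContDiff ℝ 2 (v σ) := hvs.of_le (by norm_cast)
  have hΓ : ContDiff ℝ 2 (swirl (v σ)) := contDiff_swirl hv2
  -- continuity of both sides
  have hL : Continuous (FluidPDE.timeDerivWithin S (fun s => swirl (v s)) σ) := by
    have h1 : FluidPDE.timeDerivWithin S (fun s => swirl (v s)) σ = swirl (FluidPDE.timeDerivWithin S v σ) :=
      funext fun y => hv.smooth_velocity.timeDerivWithin_swirl_eq_swirl hσ y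
    rw [h1]
    exact (contDiff_swirl ((hv.smooth_velocity.contDiff_timeDerivWithin_slice hS hσ).of_le
      (by norm_cast : (2 : WithTop ℕ∞) ≤ _))).continuous
  have hR : Continuous fun y => -(fderiv ℝ (swirl (v σ)) y (v σ y)) :=
    ((hΓ.continuous_fderiv two_ne_zero).clm_apply hvs.continuous).neg
  refine eq_of_eq_off_ker (EuclideanSpace.proj (0 : Fin 3)) ⟨EuclideanSpace.single 0 1, by simp⟩
    hL hR (fun z hz => ?_) x
  have hz0 : z 0 ≠ 0 := by simpa using hz
  have hr : cylRadius z ≠ 0 := fun h => hz0 ((cylRadius_eq_zero_iff z).1 h).1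
  have h := swirl_transport_holds hv hax hq hσ hr
  have hswirl0 : swirl ((0 : ℝ → (EuclideanSpace ℝ (Fin 3)) → (EuclideanSpace ℝ (Fin 3))) σ) z = 0 := by
    simp [swirl]
  rw [zero_mul, zero_add, hswirl0, convect_apply] at h
  linarith

/-- The powers `Γ^k` of the swirl of a jointly smooth field form a jointly smooth family. [folklore] -/
theorem isSmoothSpaceTimeOn_swirl_pow {S : Set ℝ}
    {v : ℝ → (EuclideanSpace ℝ (Fin 3)) → (EuclideanSpace ℝ (Fin 3))} (h : IsSmoothSpaceTimeOn S v) (k : ℕ) :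
    IsSmoothSpaceTimeOn S (fun s y => swirl (v s) y ^ k) := by
  have h1 : IsSmoothSpaceTimeOn S (fun s => swirl (v s)) := h.swirl_family
  have h2 : uncurry (fun s (y : EuclideanSpace ℝ (Fin 3)) => swirl (v s) y ^ k) =
      fun z => uncurry (fun s => swirl (v s)) z ^ k := rfl
  unfold IsSmoothSpaceTimeOn
  rw [h2]
  exact h1.pow k

/-- **`∂ₜ(Γ^k) = −D(Γ^k)[u]` everywhere** along a classical axisymmetric Euler flow (chain rule on
`timeDerivWithin_swirl_eq_neg`). [folklore] -/
theorem timeDerivWithin_swirl_pow_eq_neg {S : Set ℝ} (hS : UniqueDiffOn ℝ S)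
    {v : ℝ → (EuclideanSpace ℝ (Fin 3)) → (EuclideanSpace ℝ (Fin 3))} {q : ℝ → (EuclideanSpace ℝ (Fin 3)) → ℝ}
    (hv : IsClassicalNSSolutionOn S 0 0 v q) (hax : ∀ σ ∈ S, IsAxisymmetric (v σ))
    (k : ℕ) {σ : ℝ} (hσ : σ ∈ S) (x : (EuclideanSpace ℝ (Fin 3))) :
    FluidPDE.timeDerivWithin S (fun s y => swirl (v s) y ^ k) σ x =
      -(fderiv ℝ (fun y => swirl (v σ) y ^ k) x (v σ x)) := by
  have hΓt : HasDerivWithinAt (fun s => swirl (v s) x)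
      (FluidPDE.timeDerivWithin S (fun s => swirl (v s)) σ x) S σ :=
    hv.smooth_velocity.swirl_family.hasDerivWithinAt_timeDerivWithin hS hσ x
  have hv1 : DifferentiableAt ℝ (v σ) x := ((hv.contDiff_velocity hσ).differentiable (by simp)) x
  have hΓx : DifferentiableAt ℝ (swirl (v σ)) x := differentiableAt_swirl hv1
  -- time side
  have ht : FluidPDE.timeDerivWithin S (fun s y => swirl (v s) y ^ k) σ x =
      (k : ℝ) * swirl (v σ) x ^ (k - 1) * FluidPDE.timeDerivWithin S (fun s => swirl (v s)) σ x := by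
    rw [timeDerivWithin_apply, (hΓt.fun_pow k).derivWithin (hS σ hσ)]
  -- space side
  have hx : fderiv ℝ (fun y => swirl (v σ) y ^ k) x (v σ x) =
      (k : ℝ) * swirl (v σ) x ^ (k - 1) * fderiv ℝ (swirl (v σ)) x (v σ x) := by
    rw [show (fun y => swirl (v σ) y ^ k) = swirl (v σ) ^ k from rfl, fderiv_pow _ hΓx]
    simp [smul_eq_mul]
  rw [ht, hx, timeDerivWithin_swirl_eq_neg hS hv hax hσ x]
  ring

/-! ## Conservation of `∫ Γ^{2k}` -/

/-- **Conservation of `∫ (r u_θ)^{2k}` along a classical axisymmetric Euler flow on `(−∞, 0)`**: for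
`(u, p)` classical on the open slab with axisymmetric slices, `k : ℕ`, and `s < t < 0` such that on
`[s, t]` the velocity and its gradient are bounded by `B` and `Γ(τ)^k ∈ L²` with `∫ Γ(τ)^{2k} ≤ N`, one
has `∫ Γ(t)^{2k} = ∫ Γ(s)^{2k}` (Kelvin: `D/Dt (r u_θ) = 0`). [folklore] -/
theorem integral_swirl_pow_eq_of_classical
    {u : ℝ → (EuclideanSpace ℝ (Fin 3)) → (EuclideanSpace ℝ (Fin 3))} {p : ℝ → (EuclideanSpace ℝ (Fin 3)) → ℝ}
    (hns : IsClassicalNSSolutionOn (Iio 0) 0 0 u p)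
    (hax : ∀ τ : ℝ, τ < 0 → IsAxisymmetric (u τ)) (k : ℕ)
    {s t : ℝ} (hst : s < t) (ht : t < 0)
    {B : ℝ} (hB : ∀ τ ∈ Icc s t, ∀ y, ‖u τ y‖ ≤ B ∧ ‖fderiv ℝ (u τ) y‖ ≤ B)
    {N : ℝ} (hN : ∀ τ ∈ Icc s t, Integrable (fun y => (swirl (u τ) y ^ k) ^ 2) ∧
      ∫ y, (swirl (u τ) y ^ k) ^ 2 ≤ N) :
    ∫ y, (swirl (u t) y ^ k) ^ 2 = ∫ y, (swirl (u s) y ^ k) ^ 2 := by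
  set T : ℝ := t - s with hTdef
  have hT : 0 < T := sub_pos.2 hst
  have hS : UniqueDiffOn ℝ (Icc 0 T) := uniqueDiffOn_Icc hT
  have hsub : Icc 0 T ⊆ (fun σ : ℝ => σ + s) ⁻¹' Iio (0 : ℝ) := by
    intro σ hσ
    show σ + s < 0
    have := hσ.2; rw [hTdef] at this; linarith
  have hmem : ∀ σ ∈ Icc 0 T, σ + s ∈ Icc s t := fun σ hσ =>
    ⟨by linarith [hσ.1], by have := hσ.2; rw [hTdef] at this; linarith⟩
  have hv : IsClassicalNSSolutionOn (Icc 0 T) 0 0 (fun σ => u (σ + s)) (fun σ => p (σ + s)) :=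
    (hns.comp_add_right s).mono hsub hS
  have haxv : ∀ σ ∈ Icc 0 T, IsAxisymmetric (u (σ + s)) := fun σ hσ => hax (σ + s) (hsub hσ)
  have h := integral_sq_eq_of_transport hT (W := fun σ y => swirl (u (σ + s)) y ^ k)
    (isSmoothSpaceTimeOn_swirl_pow hv.smooth_velocity k)
    (fun σ hσ => (hv.contDiff_velocity hσ).of_le (by norm_cast)) (fun σ hσ => hv.divFree σ hσ)
    (fun σ hσ x => timeDerivWithin_swirl_pow_eq_neg hS hv haxv k hσ x)
    (fun σ hσ => hB (σ + s) (hmem σ hσ)) (fun σ hσ => hN (σ + s) (hmem σ hσ))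
  simp only [hTdef, sub_add_cancel, zero_add] at h
  exact h

end Summit.NavierStokesRegularity.NavierStokesRegularity.Theorems.PowerGaugeEulerLiouville.AxisymNoSwirl

end
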